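import Summits.AtomisticToContinuum.BoseEinsteinCondensation.Theses.BECInsertionVariance
import Summits.AtomisticToContinuum.BoseEinsteinCondensation.Theorems.BECInsertionVarianceGroundStateAccessibleSwapMass
import Summits.AtomisticToContinuum.BoseEinsteinCondensation.Theorems.BECInsertionVarianceGroundStateAccessibleFKGroundState
import Summits.AtomisticToContinuum.BoseEinsteinCondensation.Theorems.BECCutLineWeakDisorderGroundStateRigidityStubCompactness
import Summits.AtomisticToContinuum.BoseEinsteinCondensation.Theorems.BECCutLineWeakDisorderGroundStateRigidityStubFkJensen
import Literature.MathematicalPhysics.QuantumManyBody.SwapEntropy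
import Literature.MathematicalPhysics.QuantumManyBody.BoseGasDirichletWall
import HarnessLib

/-!
# `GroundStateAccessible`: the bounded-potential case from uniqueness, and the reduction

Helper for item `GroundStateAccessible` (stmt-AtomisticToContinuum-12069) of route `BECInsertionVariance`
(`Summit.AtomisticToContinuum.BoseEinsteinCondensation.Theses.BECInsertionVariance.GroundStateAccessible`:
for admissible `v`, small `ρ` and all large `N = n + 1`, the accessible swap mass of THE nonnegative
Dirichlet ground state `groundState v N (N/ρ)^{1/3}` is `≥ 1/2`).

* `swapMass_groundState_eq_one_of_hasUniqueGroundState` — BOUNDED `v`, one box: if the closed-form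
  ground state in `Λ_L^{n+1}` is unique up to phase (`HasUniqueGroundState`), then `groundState` agrees
  a.e. up to a phase with the Feynman–Kac ground state (a closed-form ground state by
  `isGroundState_fkGroundState_of_bounded`, strictly positive on the open box), so it is a.e. nonzero
  on the box and ALL of its two-replica mass is accessible: `swapMass = 1`
  (`swapMass_eq_one_of_ae_ne_zero`).
* `hasUniqueGroundState_of_stubs` — BOUNDED `v`, `N ≥ 1`, `L > 0`: uniqueness of the closed-form
  ground state from the two registered, not yet landed stubs `stub_stabilityOfJensen` and
  `stub_uniqueOfStability` of crux `GroundStateRigidity` (stmt-AtomisticToContinuum-9072, line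
  `Sketch`), taken VERBATIM as hypotheses, composed with the landed `stub_fkJensen`,
  `stub_compactness` and `GroundStateFeynmanKac_holds` exactly as in that line's composition — so
  that landing those two stubs discharges the bounded half of this item.
* `groundStateAccessible_of_unique_of_unbounded` / `groundStateAccessible_of_stubs_of_unbounded` —
  the item follows from (U) [resp. the two stubs] and (H): the item's own conclusion for UNBOUNDED
  admissible `v` (hard cores, shells, non-integrable cores), where the support of `Ψ₀` is a proper
  subset of the box and the bound needs the irreducibility of the accessible region
  (`stub_uniqueUnbounded` of stmt-9072, open) plus a one-body density bound uniform in `N` — neither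
  in the tree nor in print. The hard-core branch is isolated verbatim as (H).
-/

noncomputable section

open MeasureTheory Filter Set
open scoped ENNReal NNReal Topology

namespace Summit.AtomisticToContinuum.BoseEinsteinCondensation.Theorems.BECInsertionVariance

open Literature.MathematicalPhysics.QuantumManyBody.BoseGas
open Summit.AtomisticToContinuum.BoseEinsteinCondensation.Theses.BECInsertionVariance
open Summit.AtomisticToContinuum.BoseEinsteinCondensation.Theorems.GroundStateRigidity
  (stub_compactness stub_fkJensen)

/-! ### Bounded `v`: accessible mass from uniqueness -/

/-- **Bounded `v`, unique ground state ⇒ all swap mass accessible.** For a measurable bounded pair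
profile `v`, `L > 0`, and `n + 1` particles: if the closed-form Dirichlet ground state in `Λ_L^{n+1}`
is unique up to phase, then `groundState v (n+1) L` is a.e. nonzero on the box (it is a.e. a phase
times the strictly positive Feynman–Kac ground state) and `swapMass n (groundState v (n+1) L) = 1`.
[cite: ReedSimonIV1978, §XIII.12 Thms XIII.46–XIII.47] -/
theorem swapMass_groundState_eq_one_of_hasUniqueGroundState {n : ℕ} {L : ℝ} {v : ℝ → ℝ≥0∞}
    (hL : 0 < L) (hv : Measurable v) (hb : ∃ C : ℝ≥0, ∀ r, v r ≤ C)
    (hU : HasUniqueGroundState v (n + 1) L) :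
    swapMass n (groundState v (n + 1) L) = 1 := by
  have hN : 1 ≤ n + 1 := Nat.succ_pos n
  obtain ⟨hφGS, -, hφpos⟩ := isGroundState_fkGroundState_of_bounded hN hL hv hb
  have hgs : IsGroundState v L (fun X => (groundState v (n + 1) L X : ℂ)) :=
    hU.isGroundState_groundState
  obtain ⟨c, -, hae⟩ := hU.2 _ _ hgs hφGS
  -- a.e. on the box `groundState ≠ 0`
  have hne : ∀ᵐ X : Config (n + 1), X ∈ boxN (n + 1) L → groundState v (n + 1) L X ≠ 0 := by
    filter_upwards [hae] with X hX hXbox h0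
    have h1 : (fkGroundState v (n + 1) L X : ℂ) = 0 := by rw [hX, h0]; simp
    exact (hφpos X hXbox).ne' (by exact_mod_cast h1)
  exact swapMass_eq_one_of_ae_ne_zero (measurable_groundState v (n + 1) L)
    (groundState_nonneg v (n + 1) L) (fun X hX => groundState_eq_zero_of_not_mem v hX) hne
    (lintegral_groundState_sq hU.1)

/-! ### Bounded `v`: uniqueness from the two outstanding stubs of crux `GroundStateRigidity` -/

/-- **Uniqueness of the Dirichlet ground state for bounded `v`, from the registered stubs
`stub_stabilityOfJensen` (hypothesis `hS`) and `stub_uniqueOfStability` (hypothesis `hUS`) of crux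
stmt-AtomisticToContinuum-9072** (verbatim), composed with the landed `stub_fkJensen`,
`stub_compactness` and `GroundStateFeynmanKac_holds`: for `N ≥ 1`, `L > 0` and measurable `v ≤ C`,
`HasUniqueGroundState v N L`. [cite: ReedSimonIV1978, §XIII.12 Thms XIII.44 and XIII.47] -/
theorem hasUniqueGroundState_of_stubs
    (hS : ∀ (N : ℕ) (v : ℝ → ℝ≥0∞) (C : ℝ≥0) (L : ℝ), 1 ≤ N → Measurable v → (∀ r, v r ≤ C) →
      0 < L →
      (∀ f : Config N → ℝ, ContDiff ℝ 1 f → (∀ X, X ∉ boxN N L → f X = 0) →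
        (∫ X, f X ^ 2) * Real.exp (-(((∫⁻ X, realKinetic f X).toReal +
            (∫⁻ X, interaction v X * ‖f X‖ₑ ^ 2).toReal) / ∫ X, f X ^ 2)) ≤
          ∫ X in boxN N L, f X * fkReal v L 1 f X) →
      ∃ κ : ℝ, 0 < κ ∧ ∃ e : Config N → ℝ, Measurable e ∧ (∀ X, 0 ≤ e X) ∧
        ∫ X in boxN N L, e X ^ 2 = 1 ∧
        ∀ f : Config N → ℝ, ContDiff ℝ 1 f → (∀ X, X ∉ boxN N L → f X = 0) →
          ((groundStateEnergy v N L).toReal + κ) * ∫ X, f X ^ 2 ≤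
            (∫⁻ X, realKinetic f X).toReal + (∫⁻ X, interaction v X * ‖f X‖ₑ ^ 2).toReal +
              κ * (∫ X in boxN N L, e X * f X) ^ 2)
    (hUS : (∀ (N : ℕ) (L : ℝ) (v : ℝ → ℝ≥0∞) (E : ℝ≥0∞) (Φ : ℕ → TrialState N L), E ≠ ⊤ →
      (∀ n, energy v (Φ n) ≤ E) →
      ∃ (Ψ : Config N → ℂ) (φ : ℕ → ℕ), StrictMono φ ∧ Measurable Ψ ∧
        (∀ X, X ∉ boxN N L → Ψ X = 0) ∧
        (∀ (σ : Equiv.Perm (Fin N)) (X : Config N), Ψ (X ∘ σ) = Ψ X) ∧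
        TendstoL2 (fun n => Φ (φ n)) Ψ) →
    ∀ (N : ℕ) (v : ℝ → ℝ≥0∞) (L : ℝ), groundStateEnergy v N L ≠ ⊤ →
      (∃ κ : ℝ, 0 < κ ∧ ∃ e : Config N → ℝ, Measurable e ∧ (∀ X, 0 ≤ e X) ∧
        ∫ X in boxN N L, e X ^ 2 = 1 ∧
        ∀ f : Config N → ℝ, ContDiff ℝ 1 f → (∀ X, X ∉ boxN N L → f X = 0) →
          ((groundStateEnergy v N L).toReal + κ) * ∫ X, f X ^ 2 ≤
            (∫⁻ X, realKinetic f X).toReal + (∫⁻ X, interaction v X * ‖f X‖ₑ ^ 2).toReal +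
              κ * (∫ X in boxN N L, e X * f X) ^ 2) →
      HasUniqueGroundState v N L)
    {N : ℕ} {v : ℝ → ℝ≥0∞} {L : ℝ} (hN : 1 ≤ N) (hL : 0 < L) (hv : Measurable v)
    {C : ℝ≥0} (hC : ∀ r, v r ≤ C) : HasUniqueGroundState v N L := by
  obtain ⟨Ψ₀, hΨ₀, -, -⟩ := GroundStateFeynmanKac_holds N L v hN hL hv ⟨C, hC⟩
  have hE : groundStateEnergy v N L ≠ ⊤ := hΨ₀.energy_ne_top
  have hJ := stub_fkJensen N v C L hv hC hL
  exact hUS stub_compactness N v L hE (hS N v C L hN hv hC hL hJ)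

/-! ### The reductions -/

/-- **Reduction of `GroundStateAccessible`, I.** The item follows from
(U) for every BOUNDED repulsive finite-range `v`: `∃ ρ₀ > 0, ∀ ρ ∈ (0, ρ₀), ∀ᶠ N`, the Dirichlet
ground state in the box of side `(N/ρ)^{1/3}` is unique up to phase (`HasUniqueGroundState`), and
(H) for every UNBOUNDED repulsive finite-range `v`: the item's conclusion itself (accessible swap mass
of `groundState` eventually `≥ 1/2`).
Under (U) the bounded case has swap mass exactly `1`
(`swapMass_groundState_eq_one_of_hasUniqueGroundState`). [folklore] -/
theorem groundStateAccessible_of_unique_of_unbounded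
    (hUniq : ∀ v : ℝ → ℝ≥0∞, IsRepulsiveFiniteRange v → (∃ C : ℝ≥0, ∀ r, v r ≤ C) →
      ∃ ρ₀ : ℝ, 0 < ρ₀ ∧ ∀ ρ : ℝ, 0 < ρ → ρ < ρ₀ → ∀ᶠ N : ℕ in atTop,
        HasUniqueGroundState v N (sideLength ρ N))
    (hHard : ∀ v : ℝ → ℝ≥0∞, IsRepulsiveFiniteRange v → (¬ ∃ C : ℝ≥0, ∀ r, v r ≤ C) →
      ∃ ρ₀ : ℝ, 0 < ρ₀ ∧ ∀ ρ : ℝ, 0 < ρ → ρ < ρ₀ → ∀ᶠ n : ℕ in atTop,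
        (1 / 2 : ℝ≥0∞) ≤ swapMass n (groundState v (n + 1) (sideLength ρ (n + 1)))) :
    GroundStateAccessible := by
  intro v hv
  by_cases hb : ∃ C : ℝ≥0, ∀ r, v r ≤ C
  · obtain ⟨ρ₀, hρ₀, hev⟩ := hUniq v hv hb
    refine ⟨ρ₀, hρ₀, fun ρ hρ hρ' => ?_⟩
    have hev' : ∀ᶠ n : ℕ in atTop, HasUniqueGroundState v (n + 1) (sideLength ρ (n + 1)) :=
      (tendsto_add_atTop_nat 1).eventually (hev ρ hρ hρ')
    filter_upwards [hev'] with n hn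
    show (1 / 2 : ℝ≥0∞) ≤ swapMass n (groundState v (n + 1) (sideLength ρ (n + 1)))
    rw [swapMass_groundState_eq_one_of_hasUniqueGroundState
      (sideLength_pos_of_pos hρ (Nat.succ_pos n)) hv.1 hb hn]
    exact ENNReal.half_le_self
  · obtain ⟨ρ₀, hρ₀, hev⟩ := hHard v hv hb
    refine ⟨ρ₀, hρ₀, fun ρ hρ hρ' => ?_⟩
    filter_upwards [hev ρ hρ hρ'] with n hn
    exact hn

/-- **Reduction of `GroundStateAccessible`, II (what is left, named).** The item follows from the
two outstanding registered stubs of crux stmt-AtomisticToContinuum-9072 for BOUNDED potentials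
(`stub_stabilityOfJensen`, `stub_uniqueOfStability`, verbatim as `hS`, `hUS`; with them the bounded
case holds at EVERY density, `ρ₀ = 1`, with swap mass `1`) and the hard-core branch (H) of
`groundStateAccessible_of_unique_of_unbounded`. [folklore] -/
theorem groundStateAccessible_of_stubs_of_unbounded
    (hS : ∀ (N : ℕ) (v : ℝ → ℝ≥0∞) (C : ℝ≥0) (L : ℝ), 1 ≤ N → Measurable v → (∀ r, v r ≤ C) →
      0 < L →
      (∀ f : Config N → ℝ, ContDiff ℝ 1 f → (∀ X, X ∉ boxN N L → f X = 0) →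
        (∫ X, f X ^ 2) * Real.exp (-(((∫⁻ X, realKinetic f X).toReal +
            (∫⁻ X, interaction v X * ‖f X‖ₑ ^ 2).toReal) / ∫ X, f X ^ 2)) ≤
          ∫ X in boxN N L, f X * fkReal v L 1 f X) →
      ∃ κ : ℝ, 0 < κ ∧ ∃ e : Config N → ℝ, Measurable e ∧ (∀ X, 0 ≤ e X) ∧
        ∫ X in boxN N L, e X ^ 2 = 1 ∧
        ∀ f : Config N → ℝ, ContDiff ℝ 1 f → (∀ X, X ∉ boxN N L → f X = 0) →
          ((groundStateEnergy v N L).toReal + κ) * ∫ X, f X ^ 2 ≤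
            (∫⁻ X, realKinetic f X).toReal + (∫⁻ X, interaction v X * ‖f X‖ₑ ^ 2).toReal +
              κ * (∫ X in boxN N L, e X * f X) ^ 2)
    (hUS : (∀ (N : ℕ) (L : ℝ) (v : ℝ → ℝ≥0∞) (E : ℝ≥0∞) (Φ : ℕ → TrialState N L), E ≠ ⊤ →
      (∀ n, energy v (Φ n) ≤ E) →
      ∃ (Ψ : Config N → ℂ) (φ : ℕ → ℕ), StrictMono φ ∧ Measurable Ψ ∧
        (∀ X, X ∉ boxN N L → Ψ X = 0) ∧
        (∀ (σ : Equiv.Perm (Fin N)) (X : Config N), Ψ (X ∘ σ) = Ψ X) ∧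
        TendstoL2 (fun n => Φ (φ n)) Ψ) →
    ∀ (N : ℕ) (v : ℝ → ℝ≥0∞) (L : ℝ), groundStateEnergy v N L ≠ ⊤ →
      (∃ κ : ℝ, 0 < κ ∧ ∃ e : Config N → ℝ, Measurable e ∧ (∀ X, 0 ≤ e X) ∧
        ∫ X in boxN N L, e X ^ 2 = 1 ∧
        ∀ f : Config N → ℝ, ContDiff ℝ 1 f → (∀ X, X ∉ boxN N L → f X = 0) →
          ((groundStateEnergy v N L).toReal + κ) * ∫ X, f X ^ 2 ≤
            (∫⁻ X, realKinetic f X).toReal + (∫⁻ X, interaction v X * ‖f X‖ₑ ^ 2).toReal +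
              κ * (∫ X in boxN N L, e X * f X) ^ 2) →
      HasUniqueGroundState v N L)
    (hHard : ∀ v : ℝ → ℝ≥0∞, IsRepulsiveFiniteRange v → (¬ ∃ C : ℝ≥0, ∀ r, v r ≤ C) →
      ∃ ρ₀ : ℝ, 0 < ρ₀ ∧ ∀ ρ : ℝ, 0 < ρ → ρ < ρ₀ → ∀ᶠ n : ℕ in atTop,
        (1 / 2 : ℝ≥0∞) ≤ swapMass n (groundState v (n + 1) (sideLength ρ (n + 1)))) :
    GroundStateAccessible := by
  refine groundStateAccessible_of_unique_of_unbounded (fun v hv hb => ?_) hHard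
  obtain ⟨C, hC⟩ := hb
  refine ⟨1, one_pos, fun ρ hρ _ => ?_⟩
  filter_upwards [eventually_ge_atTop 1] with N hN
  exact hasUniqueGroundState_of_stubs hS hUS hN (sideLength_pos_of_pos hρ hN) hv.1 hC

end Summit.AtomisticToContinuum.BoseEinsteinCondensation.Theorems.BECInsertionVariance

end
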